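/-
Copyright (c) 2026. Released under Apache 2.0 license.

# CDT Theorem 1.0.1, holonomic side: `q`-expansion calculus and the independence transfer

The `q`-expansion at a fixed period `P` is a ring homomorphism on the algebra of `P`-periodic
holomorphic functions on `ℍ` bounded at `i∞` (Mathlib: `qExpansion_add`, `qExpansion_mul`), and it
is injective there (`qExpansion_eq_zero_iff`).  We record the closure properties of this algebra,
the resulting formulas for finite sums and polynomial expressions, and deduce the **independence
transfer** used in the proof of [CalegariDimitrovTang2025, Theorem 1.0.1, §6.3]: a formal
`ℚ[X^N]`-linear relation among the series `f_i ∈ ℚ⟦X⟧` attached to generators `F_i/Δ^{m_i}` of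
`R_{2N}` (`f_i(x) = 𝓣[(λ/16)^{2m_i} F_i/Δ^{m_i}]`, `x^N = Λ₁₆(q^N)`) yields an `M_2 = ℂ(λ)`-linear
relation among the `F_i/Δ^{m_i}`; so for an `M_2`-linearly independent family all the polynomial
coefficients vanish (`λ` takes infinitely many values).
-/
import Literature.NumberTheory.Automorphic.UnboundedDenominatorsGeneratorQExpansion
import Literature.NumberTheory.Automorphic.UnboundedDenominatorsLambdaProofs
import Literature.NumberTheory.Automorphic.ModularLambdaSurjective
import HarnessLib

open Complex Real Filter Topology Function Metric Set Asymptotics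
open UpperHalfPlane hiding I
open scoped Real Topology Manifold MatrixGroups ModularForm Polynomial

namespace Literature.NumberTheory.Automorphic

namespace UnboundedDenominators

open _root_.Complex Literature.NumberTheory.Automorphic.ModularLambda ModularGroup
  CongruenceSubgroup Matrix.SpecialLinearGroup Literature.Analysis.Complex

/-! ### The algebra of periodic holomorphic functions bounded at `i∞` -/

section Algebra

variable {P : ℝ}

/-- Post-composition preserves periodicity. [cite: DiamondShurman2005, §1.1 p. 3] -/
theorem periodic_comp_comp_ofComplex {f : ℍ → ℂ} (hf : Periodic (f ∘ ofComplex) P) (φ : ℂ → ℂ) :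
    Periodic ((fun τ : ℍ ↦ φ (f τ)) ∘ ofComplex) P := fun x ↦ by
  simpa only [Function.comp_apply] using congrArg φ (hf x)

/-- Sums of `P`-periodic functions are `P`-periodic. [cite: DiamondShurman2005, §1.1 p. 3] -/
theorem periodic_add_comp_ofComplex {f g : ℍ → ℂ} (hf : Periodic (f ∘ ofComplex) P)
    (hg : Periodic (g ∘ ofComplex) P) : Periodic ((f + g) ∘ ofComplex) P := fun x ↦ by
  have h1 := hf x
  have h2 := hg x
  simp only [Function.comp_apply, Pi.add_apply] at h1 h2 ⊢
  rw [h1, h2]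

/-- Products of `P`-periodic functions are `P`-periodic. [cite: DiamondShurman2005, §1.1 p. 3] -/
theorem periodic_mul_comp_ofComplex {f g : ℍ → ℂ} (hf : Periodic (f ∘ ofComplex) P)
    (hg : Periodic (g ∘ ofComplex) P) : Periodic ((f * g) ∘ ofComplex) P := fun x ↦ by
  have h1 := hf x
  have h2 := hg x
  simp only [Function.comp_apply, Pi.mul_apply] at h1 h2 ⊢
  rw [h1, h2]

/-- Finite sums of `P`-periodic functions are `P`-periodic. [cite: DiamondShurman2005, §1.1 p. 3] -/
theorem periodic_sum_comp_ofComplex {ι : Type*} (s : Finset ι) {f : ι → ℍ → ℂ}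
    (hf : ∀ i ∈ s, Periodic (f i ∘ ofComplex) P) : Periodic ((∑ i ∈ s, f i) ∘ ofComplex) P := by
  classical
  induction s using Finset.induction_on with
  | empty => intro x; simp
  | insert a s ha ih =>
    rw [Finset.sum_insert ha]
    exact periodic_add_comp_ofComplex (hf a (Finset.mem_insert_self a s))
      (ih fun i hi ↦ hf i (Finset.mem_insert_of_mem hi))

/-- Finite sums of functions bounded at `i∞` are bounded at `i∞` (a copy of
`Literature.NumberTheory.EllipticCurves.ModularForms.isBoundedAtImInfty_sum`, kept private to avoid
importing the elliptic-curve hierarchy). [folklore] -/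
private theorem isBoundedAtImInfty_sum {ι : Type*} (s : Finset ι) {f : ι → ℍ → ℂ}
    (hf : ∀ i ∈ s, IsBoundedAtImInfty (f i)) : IsBoundedAtImInfty (∑ i ∈ s, f i) := by
  classical
  induction s using Finset.induction_on with
  | empty => rw [Finset.sum_empty]; exact const_boundedAtFilter atImInfty (0 : ℂ)
  | insert a s ha ih =>
    rw [Finset.sum_insert ha]
    exact (hf a (Finset.mem_insert_self a s)).add (ih fun i hi ↦ hf i (Finset.mem_insert_of_mem hi))

/-- Finite sums of holomorphic functions on `ℍ` are holomorphic (a copy of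
`Literature.NumberTheory.EllipticCurves.ModularForms.mdifferentiable_finset_sum`, kept private).
[folklore] -/
private theorem mdifferentiable_sum {ι : Type*} (s : Finset ι) {f : ι → ℍ → ℂ}
    (hf : ∀ i ∈ s, MDiff (f i)) : MDiff (∑ i ∈ s, f i) := by
  classical
  induction s using Finset.induction_on with
  | empty => rw [Finset.sum_empty]; exact mdifferentiable_const
  | insert a s ha ih =>
    rw [Finset.sum_insert ha]
    exact (hf a (Finset.mem_insert_self a s)).add (ih fun i hi ↦ hf i (Finset.mem_insert_of_mem hi))

/-- A polynomial expression in a holomorphic function on `ℍ` is holomorphic.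
[cite: DiamondShurman2005, §1.1 p. 3] -/
theorem mdifferentiable_polynomial_eval {f : ℍ → ℂ} (hf : MDiff f) (Q : ℂ[X]) :
    MDiff (fun τ : ℍ ↦ Q.eval (f τ)) :=
  (Q.differentiable.mdifferentiable).comp hf

/-- A polynomial expression in a function bounded at `i∞` is bounded at `i∞`.
[cite: DiamondShurman2005, §1.1 p. 3] -/
theorem isBoundedAtImInfty_polynomial_eval {f : ℍ → ℂ} (hf : IsBoundedAtImInfty f) (Q : ℂ[X]) :
    IsBoundedAtImInfty (fun τ : ℍ ↦ Q.eval (f τ)) := by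
  induction Q using Polynomial.induction_on' with
  | add p q hp hq =>
    simp only [Polynomial.eval_add]
    exact hp.add hq
  | monomial n c =>
    simp only [Polynomial.eval_monomial]
    have h := (const_boundedAtFilter atImInfty c).mul (isBoundedAtImInfty_pow hf n)
    exact h

/-- **The `q`-expansion of a finite sum** of `P`-periodic holomorphic functions bounded at `i∞`
is the sum of the `q`-expansions. [cite: DiamondShurman2005, §1.1 p. 3] -/
theorem qExpansion_sum (hP : 0 < P) {ι : Type*} (s : Finset ι) {f : ι → ℍ → ℂ}
    (hper : ∀ i ∈ s, Periodic (f i ∘ ofComplex) P) (hhol : ∀ i ∈ s, MDiff (f i))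
    (hbdd : ∀ i ∈ s, IsBoundedAtImInfty (f i)) :
    qExpansion P (∑ i ∈ s, f i) = ∑ i ∈ s, qExpansion P (f i) := by
  classical
  induction s using Finset.induction_on with
  | empty => simp [qExpansion_zero]
  | insert a s ha ih =>
    have hs : ∀ i ∈ s, i ∈ insert a s := fun i hi ↦ Finset.mem_insert_of_mem hi
    rw [Finset.sum_insert ha, Finset.sum_insert ha, qExpansion_add, ih (fun i hi ↦ hper i (hs i hi))
      (fun i hi ↦ hhol i (hs i hi)) (fun i hi ↦ hbdd i (hs i hi))]
    · exact analyticAt_cuspFunction_zero hP (hper a (Finset.mem_insert_self a s))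
        (hhol a (Finset.mem_insert_self a s)) (hbdd a (Finset.mem_insert_self a s))
    · exact analyticAt_cuspFunction_zero hP
        (periodic_sum_comp_ofComplex s fun i hi ↦ hper i (hs i hi))
        (mdifferentiable_sum s fun i hi ↦ hhol i (hs i hi))
        (isBoundedAtImInfty_sum s fun i hi ↦ hbdd i (hs i hi))

/-- **The `q`-expansion of a polynomial expression** `Q(f)` in a `P`-periodic holomorphic function
`f` bounded at `i∞` is `Q` evaluated at the `q`-expansion of `f`. [cite: DiamondShurman2005, §1.1
p. 3] -/
theorem qExpansion_polynomial_eval (hP : 0 < P) {f : ℍ → ℂ} (hper : Periodic (f ∘ ofComplex) P)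
    (hhol : MDiff f) (hbdd : IsBoundedAtImInfty f) (Q : ℂ[X]) :
    qExpansion P (fun τ : ℍ ↦ Q.eval (f τ)) = Polynomial.aeval (qExpansion P f) Q := by
  induction Q using Polynomial.induction_on' with
  | add p q hp hq =>
    have e : (fun τ : ℍ ↦ (p + q).eval (f τ)) =
        (fun τ : ℍ ↦ p.eval (f τ)) + fun τ : ℍ ↦ q.eval (f τ) := by
      funext τ; simp only [Polynomial.eval_add, Pi.add_apply]
    rw [e, qExpansion_add, hp, hq, map_add]
    · exact analyticAt_cuspFunction_zero hP (periodic_comp_comp_ofComplex hper fun z ↦ p.eval z)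
        (mdifferentiable_polynomial_eval hhol p) (isBoundedAtImInfty_polynomial_eval hbdd p)
    · exact analyticAt_cuspFunction_zero hP (periodic_comp_comp_ofComplex hper fun z ↦ q.eval z)
        (mdifferentiable_polynomial_eval hhol q) (isBoundedAtImInfty_polynomial_eval hbdd q)
  | monomial n c =>
    have e : (fun τ : ℍ ↦ (Polynomial.monomial n c).eval (f τ)) = c • (f ^ n) := by
      funext τ; simp only [Polynomial.eval_monomial, Pi.smul_apply, Pi.pow_apply, smul_eq_mul]
    rw [e, qExpansion_smul, qExpansion_pow hP hper hhol hbdd, Polynomial.aeval_monomial,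
      Algebra.smul_def]
    exact analyticAt_cuspFunction_zero hP (periodic_pow_comp_ofComplex hper n) (hhol.pow n)
      (isBoundedAtImInfty_pow hbdd n)

end Algebra


/-! ### From a formal `ℚ[X^N]`-relation to a relation between functions -/

/-- **Formal relations descend to functions.**  Let `x ∈ X + X²ℚ⟦X⟧` with `x^N = L(X^N)`
(`L` the nome expansion of `λ/16`), let `h_i` be `2N`-periodic holomorphic functions on `ℍ` bounded
at `i∞` whose `q_{2N}`-expansions are `H_i ∈ ℤ⟦q⟧`, and let `f_i ∈ ℚ⟦X⟧` with `f_i(x) = H_i`.  Then a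
formal relation `Σ Q_i(X^N) f_i = 0` (`Q_i ∈ ℚ[Y]`) forces the relation
`Σ Q_i(λ/16) · h_i = 0` between functions on `ℍ` (substitute `X ↦ x`, read the result as the
vanishing of the `q_{2N}`-expansion of `Σ Q_i(λ/16) h_i`, and use injectivity of `q`-expansions).
[cite: CalegariDimitrovTang2025, §6.3, proof of Theorem 1.0.1] -/
theorem sum_polynomial_modularLambda_mul_eq_zero_of_formal {N : ℕ} (hN : 0 < N) {m : ℕ}
    {L : PowerSeries ℤ}
    (hL : qExpansion 2 (fun τ : ℍ ↦ modularLambda τ / 16) = L.map (Int.castRingHom ℂ))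
    {x : PowerSeries ℚ} (hx0 : PowerSeries.constantCoeff x = 0)
    (hxN : x ^ N = PowerSeries.expand N hN.ne' (L.map (Int.castRingHom ℚ)))
    {h : Fin m → ℍ → ℂ} (hper : ∀ i, Periodic (h i ∘ ofComplex) (((2 * N : ℕ) : ℝ) : ℂ))
    (hhol : ∀ i, MDiff (h i)) (hbdd : ∀ i, IsBoundedAtImInfty (h i))
    {H : Fin m → PowerSeries ℤ}
    (hH : ∀ i, qExpansion ((2 * N : ℕ) : ℝ) (h i) = (H i).map (Int.castRingHom ℂ))
    {f : Fin m → PowerSeries ℚ} (hf : ∀ i, (f i).subst x = (H i).map (Int.castRingHom ℚ))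
    {Q : Fin m → ℚ[X]}
    (hrel : ∑ i, Polynomial.aeval ((PowerSeries.X : PowerSeries ℚ) ^ N) (Q i) * f i = 0) (τ : ℍ) :
    ∑ i, ((Q i).map (algebraMap ℚ ℂ)).eval (modularLambda τ / 16) * h i τ = 0 := by
  classical
  set P : ℝ := ((2 * N : ℕ) : ℝ) with hPdef
  have hP : 0 < P := by rw [hPdef]; exact_mod_cast (by omega : 0 < 2 * N)
  -- substitute `X ↦ x`
  have hsx : PowerSeries.HasSubst x := PowerSeries.HasSubst.of_constantCoeff_zero' hx0
  have h1 : ∑ i, Polynomial.aeval (x ^ N) (Q i) * (H i).map (Int.castRingHom ℚ) = 0 := by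
    have := congrArg (PowerSeries.substAlgHom hsx) hrel
    rw [map_sum, map_zero] at this
    rw [← this]
    refine Finset.sum_congr rfl fun i _ ↦ ?_
    rw [map_mul, ← Polynomial.aeval_algHom_apply, map_pow, PowerSeries.substAlgHom_X,
      PowerSeries.coe_substAlgHom, hf i]
  -- map to `ℂ⟦X⟧`
  set ι : PowerSeries ℚ →+* PowerSeries ℂ := PowerSeries.map (algebraMap ℚ ℂ) with hι
  have hιx : ι (x ^ N) = qExpansion P (fun τ : ℍ ↦ modularLambda τ / 16) := by
    have hLL : PowerSeries.map (algebraMap ℚ ℂ) (L.map (Int.castRingHom ℚ)) =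
        L.map (Int.castRingHom ℂ) := by
      rw [← RingHom.comp_apply (PowerSeries.map (algebraMap ℚ ℂ)), ← PowerSeries.map_comp]
      congr 1
    rw [hPdef, qExpansion_modularLambda_div_sixteen_two_mul hN.ne', hL, hxN, hι,
      PowerSeries.map_expand, hLL]
  have hιH : ∀ i, ι ((H i).map (Int.castRingHom ℚ)) = qExpansion P (h i) := by
    intro i
    rw [hH i, hι, ← RingHom.comp_apply (PowerSeries.map (algebraMap ℚ ℂ)), ← PowerSeries.map_comp]
    congr 1
  have hιQ : ∀ i, ι (Polynomial.aeval (x ^ N) (Q i)) =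
      Polynomial.aeval (qExpansion P (fun τ : ℍ ↦ modularLambda τ / 16))
        ((Q i).map (algebraMap ℚ ℂ)) := by
    intro i
    rw [Polynomial.aeval_def, Polynomial.hom_eval₂, hιx, Polynomial.aeval_def, Polynomial.eval₂_map]
    congr 1
    exact RingHom.ext_rat _ _
  have h2 : ∑ i, Polynomial.aeval (qExpansion P (fun τ : ℍ ↦ modularLambda τ / 16))
      ((Q i).map (algebraMap ℚ ℂ)) * qExpansion P (h i) = 0 := by
    have := congrArg ι h1
    rw [map_sum, map_zero] at this
    rw [← this]
    refine Finset.sum_congr rfl fun i _ ↦ ?_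
    rw [map_mul, hιQ, hιH]
  -- read `h2` as the vanishing of a `q`-expansion
  have hΛper : Periodic ((fun τ : ℍ ↦ modularLambda τ / 16) ∘ ofComplex) (P : ℂ) :=
    periodic_modularLambda_div_sixteen_two_mul N
  have hΛhol : MDiff (fun τ : ℍ ↦ modularLambda τ / 16) := mdifferentiable_modularLambda_div_sixteen
  have hΛbdd : IsBoundedAtImInfty (fun τ : ℍ ↦ modularLambda τ / 16) :=
    isBoundedAtImInfty_modularLambda_div_sixteen
  set g : Fin m → ℍ → ℂ := fun i τ ↦
    ((Q i).map (algebraMap ℚ ℂ)).eval (modularLambda τ / 16) * h i τ with hg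
  have hgper : ∀ i, Periodic (g i ∘ ofComplex) (P : ℂ) := fun i ↦
    periodic_mul_comp_ofComplex (periodic_comp_comp_ofComplex hΛper fun z ↦
      ((Q i).map (algebraMap ℚ ℂ)).eval z) (hper i)
  have hghol : ∀ i, MDiff (g i) := fun i ↦
    (mdifferentiable_polynomial_eval hΛhol _).mul (hhol i)
  have hgbdd : ∀ i, IsBoundedAtImInfty (g i) := fun i ↦
    (isBoundedAtImInfty_polynomial_eval hΛbdd _).mul (hbdd i)
  have hqg : ∀ i, qExpansion P (g i) = Polynomial.aeval (qExpansion P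
      (fun τ : ℍ ↦ modularLambda τ / 16)) ((Q i).map (algebraMap ℚ ℂ)) * qExpansion P (h i) := by
    intro i
    rw [← qExpansion_polynomial_eval hP hΛper hΛhol hΛbdd, ← qExpansion_mul]
    · rfl
    · exact analyticAt_cuspFunction_zero hP (periodic_comp_comp_ofComplex hΛper fun z ↦
        ((Q i).map (algebraMap ℚ ℂ)).eval z) (mdifferentiable_polynomial_eval hΛhol _)
        (isBoundedAtImInfty_polynomial_eval hΛbdd _)
    · exact analyticAt_cuspFunction_zero hP (hper i) (hhol i) (hbdd i)
  have hsum : qExpansion P (∑ i, g i) = 0 := by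
    rw [qExpansion_sum hP Finset.univ (fun i _ ↦ hgper i) (fun i _ ↦ hghol i) (fun i _ ↦ hgbdd i)]
    simpa only [hqg] using h2
  have hzero : (∑ i, g i) = 0 :=
    (qExpansion_eq_zero_iff hP (periodic_sum_comp_ofComplex Finset.univ fun i _ ↦ hgper i)
      (mdifferentiable_sum Finset.univ fun i _ ↦ hghol i)
      (isBoundedAtImInfty_sum Finset.univ fun i _ ↦ hgbdd i)).1 hsum
  have := congr_fun hzero τ
  simpa only [Finset.sum_apply, hg, Pi.zero_apply] using this


/-! ### From a relation between functions to the vanishing of the coefficients -/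

/-- Polynomial expressions in an element of an intermediate field stay in it. [folklore] -/
private theorem aeval_mem_of_mem {K : IntermediateField ℂ Mer} {y : Mer} (hy : y ∈ K) (p : ℂ[X]) :
    Polynomial.aeval y p ∈ K := by
  rw [Polynomial.aeval_eq_sum_range]
  exact sum_mem fun n _ ↦ K.toSubalgebra.smul_mem (pow_mem hy n) _

/-- **Independence transfer.**  Let `F_i ∈ M_{12 k_i}(G_i)` be modular forms whose modular functions
`F_i/Δ^{k_i}` are linearly independent over `M_2 = ℂ(λ)` (in the field `Mer`).  If polynomials
`Q_i ∈ ℚ[Y]` satisfy `Σ_i Q_i(λ/16) (λ/16)^{2k_i} F_i/Δ^{k_i} = 0` on `ℍ`, then every `Q_i = 0`: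
the coefficients `Q_i(λ/16)(λ/16)^{2k_i}` lie in `M_2` (as `λ ∈ M_2`), so they vanish identically,
and `λ` takes infinitely many values. [cite: CalegariDimitrovTang2025, §6.3, proof of Theorem 1.0.1] -/
theorem eq_zero_of_sum_polynomial_modularLambda_mul_modFun_eq_zero {m : ℕ}
    {G : Fin m → Subgroup SL(2, ℤ)} {k : Fin m → ℕ}
    (F : (i : Fin m) → ModularForm ((G i : Subgroup (GL (Fin 2) ℝ))) (12 * (k i : ℤ)))
    (hli : LinearIndependent (levelField 2) (fun i ↦ algebraMap hol Mer (modFun (k i) (F i))))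
    {Q : Fin m → ℚ[X]}
    (hrel : ∀ τ : ℍ, ∑ i, ((Q i).map (algebraMap ℚ ℂ)).eval (modularLambda τ / 16) *
      ((modularLambda τ / 16) ^ (2 * k i) * (F i τ / ModularForm.discriminant τ ^ (k i))) = 0) :
    ∀ i, Q i = 0 := by
  classical
  obtain ⟨Lh, hLh, hLmem⟩ := exists_modularLambda_mem_levelField_two
  set ℓ : hol := (16 : ℂ)⁻¹ • Lh with hℓdef
  have hℓ : ∀ τ : ℍ, (ℓ : ℍ → ℂ) τ = modularLambda τ / 16 := by
    intro τ
    rw [hℓdef, Subalgebra.coe_smul, Pi.smul_apply, hLh, smul_eq_mul, div_eq_inv_mul]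
  have hℓmem : algebraMap hol Mer ℓ ∈ levelField 2 := by
    have e : algebraMap hol Mer ℓ = (16 : ℂ)⁻¹ • algebraMap hol Mer Lh := by
      rw [hℓdef, Algebra.smul_def, map_mul, ← IsScalarTower.algebraMap_apply, ← Algebra.smul_def]
    rw [e]
    exact (levelField 2).toSubalgebra.smul_mem hLmem _
  -- the coefficients, as elements of `hol` and of `M_2`
  set c : Fin m → hol := fun i ↦
    Polynomial.aeval ℓ ((Q i).map (algebraMap ℚ ℂ)) * ℓ ^ (2 * k i) with hcdef
  have hcmem : ∀ i, algebraMap hol Mer (c i) ∈ levelField 2 := by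
    intro i
    rw [hcdef, map_mul, map_pow, ← Polynomial.aeval_algebraMap_apply]
    exact mul_mem (aeval_mem_of_mem hℓmem _) (pow_mem hℓmem _)
  have hcapply : ∀ i (τ : ℍ), (c i : ℍ → ℂ) τ = ((Q i).map (algebraMap ℚ ℂ)).eval
      (modularLambda τ / 16) * (modularLambda τ / 16) ^ (2 * k i) := by
    intro i τ
    have e : (c i : ℍ → ℂ) = hol.val (c i) := rfl
    rw [e, hcdef, map_mul, map_pow, ← Polynomial.aeval_algHom_apply, Subalgebra.val_apply,
      Pi.mul_apply, Pi.pow_apply, Polynomial.aeval_fn_apply, Polynomial.coe_aeval_eq_eval, hℓ]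
  -- the relation in `hol`
  have hhol0 : ∑ i, c i * modFun (k i) (F i) = 0 := by
    apply Subtype.ext
    have e : ((∑ i, c i * modFun (k i) (F i) : hol) : ℍ → ℂ) =
        hol.val (∑ i, c i * modFun (k i) (F i)) := rfl
    rw [e, map_sum]
    funext τ
    rw [Finset.sum_apply]
    have : ∀ i, (hol.val (c i * modFun (k i) (F i))) τ = ((Q i).map (algebraMap ℚ ℂ)).eval
        (modularLambda τ / 16) * ((modularLambda τ / 16) ^ (2 * k i) *
          (F i τ / ModularForm.discriminant τ ^ (k i))) := by
      intro i
      rw [map_mul, Pi.mul_apply, Subalgebra.val_apply, Subalgebra.val_apply, hcapply, modFun_apply,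
        mul_assoc]
    simp only [this]
    exact hrel τ
  -- the relation in `Mer`, with coefficients in `M_2`
  have hMer : ∑ i, (⟨algebraMap hol Mer (c i), hcmem i⟩ : levelField 2) •
      algebraMap hol Mer (modFun (k i) (F i)) = 0 := by
    have e := congrArg (algebraMap hol Mer) hhol0
    rw [map_sum, map_zero] at e
    rw [← e]
    refine Finset.sum_congr rfl fun i _ ↦ ?_
    conv_rhs => rw [map_mul]
    rfl
  have hκ := Fintype.linearIndependent_iff.mp hli _ hMer
  intro i
  have hci : c i = 0 := by
    apply algebraMap_hol_injective
    rw [map_zero]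
    exact congrArg Subtype.val (hκ i)
  -- pointwise: `Q_i(λ/16) = 0` on `ℍ`
  have hroot : ∀ τ : ℍ, ((Q i).map (algebraMap ℚ ℂ)).IsRoot (modularLambda τ / 16) := by
    intro τ
    have e := hcapply i τ
    rw [hci] at e
    have hne : (modularLambda τ / 16) ^ (2 * k i) ≠ 0 :=
      pow_ne_zero _ (div_ne_zero (modularLambda_ne_zero τ.im_pos) (by norm_num))
    have : ((Q i).map (algebraMap ℚ ℂ)).eval (modularLambda τ / 16) = 0 := by
      rcases mul_eq_zero.mp e.symm with h | h
      · exact h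
      · exact absurd h hne
    exact this
  -- `λ` takes infinitely many values, so `Q_i = 0`
  have hinf : Set.Infinite {z : ℂ | ((Q i).map (algebraMap ℚ ℂ)).IsRoot z} := by
    refine Set.infinite_of_injective_forall_mem (f := fun n : ℕ ↦ ((n : ℂ) + 2) / 16)
      (fun a b hab ↦ by simpa using hab) fun n ↦ ?_
    have h0 : (n : ℂ) + 2 ≠ 0 := by
      have : (0 : ℝ) < n + 2 := by positivity
      exact_mod_cast this.ne'
    have h1 : (n : ℂ) + 2 ≠ 1 := by
      have : (1 : ℝ) < n + 2 := by linarith [n.cast_nonneg (α := ℝ)]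
      exact_mod_cast this.ne'
    obtain ⟨τ, hτ, hlam⟩ := exists_modularLambda_eq h0 h1
    have := hroot ⟨τ, hτ⟩
    simp only [Set.mem_setOf_eq]
    convert this using 2
    rw [← hlam]
  have hQ := Polynomial.eq_zero_of_infinite_isRoot _ hinf
  rwa [Polynomial.map_eq_zero_iff (algebraMap ℚ ℂ).injective] at hQ

end UnboundedDenominators

end Literature.NumberTheory.Automorphic
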